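import Summits.BirchSwinnertonDyer.Rank1Residual.GaloisImage.SelmerStructureTransport
import Literature.NumberTheory.GaloisRepresentations.CyclotomicLevels
import HarnessLib

/-!
# Transport of Selmer-structure invariants along an equivariant bijection — FILE F1a′: (H.1),
# residual coisotropy, and the `Nat.log` form of `λ^*` (cell `b2b-bsdres`, team n1011, seat p16 GEN 6;
# row T-R1-56-F1, continuation of `SelmerStructureTransport.lean`)

HONEST FRAMING (cell `b2b-bsdres`, run/shared/lean/b2b/bsd-rank1-residual/, verbatim in every
file): the goal of the cell is to DELETE the COMBINATION-SHAPED residual classes of the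
Birch–Swinnerton-Dyer formula for ALL analytic-rank `≤ 1` elliptic curves over `ℚ` — "full BSD
formula for every rank `≤ 1` curve in class `C`" assembled STRICTLY from published theorems — so
that the rank-`≤ 1` remainder becomes exactly the CONSTRUCTION-SHAPED classes, which are TYPED
(missing-input `Prop`s), NOT attempted. This is not "finishing BSD". Team n1011 (N10 / N11 / O7):
research route on the CONSTRUCTION-SHAPED class X4 (N11 = X4 ∧ p = 3); prove what is provable now; no
claim beyond stated classes; TOOL theorems about Selmer structures of finite Galois modules; nothing
booked; no mark / label moved. THEOREMS ONLY: no definition, no named fact, no `sorry`.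

## What

Same setting as `SelmerStructureTransport.lean` (`e`, `e'`, `hee'`, `he'e`; `eD`, `eD'`, `heD`,
`heD'`; `𝓕̄ = 𝓕.induced e`):
* §B′ `finite_selmerGroup_induced` / `_of_induced`, `finite_dualSelmerGroup_induced` / `_of_induced`
  — finiteness of the (dual) Selmer groups moves both ways along FILE F1a's bijections;
* §D (T3) `irreducible_of_equiv` — Sakamoto's (H.1) ("every `Γ_K`-stable subgroup is `⊥` or `⊤`",
  the slice's verbatim shape) moves from `M̄` to `M`;
* §E (T4) `isResiduallyCoisotropicAt_of_induced`, `isResiduallyCoisotropic_of_induced` — Sakamoto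
  Def. 3.8 for `(𝓕̄, θ)` gives it for `(𝓕, eD ∘ θ ∘ e)`;
* §G (T5) `h3_of_equiv` — Sakamoto's (H.3) (inflation–restriction shape, vanishing on
  `{u | ρ u = 1, u ∈ rootsOfUnityFixer K N}`) moves from `M̄` to `M` (push forward along `e`, `H¹(e)`
  injective);
* §F `natLog_natCard_eq_zero_iff` (a subgroup of a group killed by the prime `p` is `⊥` iff
  `Nat.log p` of its order is `0`; the only place a `Fact p.Prime` enters) — the log form
  `λ^*(𝓕̄) = 0 ↔ H¹_{𝓕^*}(K, M^D) = ⊥` itself is in FILE F1b (binder currency fixed with the consumer).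

References: [Sakamoto2024] §2 (H.1) (p. 921), §3.1.1 (p. 923), Def. 3.8 (p. 924), Thm. 4.4 (1)
(p. 926); [Howard2004HeegnerKolyvagin] Def. 2.1.10.
-/

noncomputable section

open scoped Classical

open Function NumberField IsDedekindDomain Field
open Literature.NumberTheory.GaloisRepresentations
open Literature.NumberTheory.GaloisRepresentations.DiscreteGaloisModule
open Literature.NumberTheory.GaloisCohomology
open Summit.BirchSwinnertonDyer.Rank1Residual.X11b.Levels
open Summit.BirchSwinnertonDyer.Rank1Residual.GaloisImage.CoreRankZero (localization_map_one_eq)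
open scoped ContRepresentation

universe u

namespace Summit.BirchSwinnertonDyer.Rank1Residual.GaloisImage.Transport

/-! ## §B′ Finiteness moves along the bijections of FILE F1a -/

section FiniteTransport

variable {K : Type u} [Field K] [NumberField K] {M Mbar : Type u}
  [AddCommGroup M] [TopologicalSpace M] [DiscreteTopology M] [Finite M]
  [AddCommGroup Mbar] [TopologicalSpace Mbar] [DiscreteTopology Mbar] [Finite Mbar]
  {ρ : DiscreteGaloisModule K M} {ρbar : DiscreteGaloisModule K Mbar} {n : ℕ}
  (e : ρ.toContRepresentation →ⁱL ρbar.toContRepresentation)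
  (e' : ρbar.toContRepresentation →ⁱL ρ.toContRepresentation)
  (eD : (ρbar.tateDual n).toContRepresentation →ⁱL (ρ.tateDual n).toContRepresentation)
  (eD' : (ρ.tateDual n).toContRepresentation →ⁱL (ρbar.tateDual n).toContRepresentation)
  (inv : LocalInvariants K n) (𝓕 : SelmerStructure ρ)

omit [Finite M] [Finite Mbar] in
/-- `H¹_𝓕(K, M)` finite ⇒ `H¹_{𝓕̄}(K, M̄)` finite (`H¹(e')` maps the latter injectively into the former,
`(𝓕̄).induced e' = 𝓕`). [cite: Sakamoto2024, §2 (p. 921)] -/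
theorem finite_selmerGroup_induced (hee' : ∀ a, e' (e a) = a) (he'e : ∀ b, e (e' b) = b)
    [hfin : Finite 𝓕.selmerGroup] : Finite (𝓕.induced e).selmerGroup := by
  refine Finite.of_injective (fun y => (⟨galoisCohomology.map e' 1 y.1, ?_⟩ : 𝓕.selmerGroup)) ?_
  · have h := (map_mem_selmerGroup_induced_iff e' e (𝓕.induced e) he'e y.1).2 y.2
    rwa [induced_induced_eq_self e e' 𝓕 hee'] at h
  · intro x y hxy
    exact Subtype.ext (map_injective_of_comp_eq e' e he'e (congrArg Subtype.val hxy))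

omit [Finite M] [Finite Mbar] in
/-- `H¹_{𝓕̄}(K, M̄)` finite ⇒ `H¹_𝓕(K, M)` finite (`H¹(e)` is injective into it).
[cite: Sakamoto2024, §2 (p. 921)] -/
theorem finite_selmerGroup_of_induced (hee' : ∀ a, e' (e a) = a)
    [hfin : Finite (𝓕.induced e).selmerGroup] : Finite 𝓕.selmerGroup :=
  Finite.of_injective (fun x => (⟨galoisCohomology.map e 1 x.1,
      (map_mem_selmerGroup_induced_iff e e' 𝓕 hee' x.1).2 x.2⟩ : (𝓕.induced e).selmerGroup))
    fun _ _ hxy => Subtype.ext (map_injective_of_comp_eq e e' hee' (congrArg Subtype.val hxy))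

/-- `H¹_{𝓕^*}(K, M^D)` finite ⇒ `H¹_{𝓕̄^*}(K, M̄^D)` finite (`H¹(eD)` is injective into it).
[cite: Howard2004HeegnerKolyvagin, Def. 2.1.10 (arXiv:1202.6340 p. 6)] -/
theorem finite_dualSelmerGroup_induced (he'e : ∀ b, e (e' b) = b)
    (heD : ∀ (f : TateDual K Mbar n) (a : M), eD f a = f (e a))
    (heD' : ∀ (g : TateDual K M n) (b : Mbar), eD' g b = g (e' b))
    [hfind : Finite (inv.dualSelmerStructure ρ 𝓕).selmerGroup] :
    Finite (inv.dualSelmerStructure ρbar (𝓕.induced e)).selmerGroup :=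
  Finite.of_injective (fun y => (⟨galoisCohomology.map eD 1 y.1,
      (map_mem_dualSelmerGroup_induced_iff e eD inv 𝓕 heD y.1).1 y.2⟩ :
        (inv.dualSelmerStructure ρ 𝓕).selmerGroup))
    fun _ _ hxy => Subtype.ext (map_injective_of_comp_eq eD eD'
      (dual_comp_eq_self e e' eD eD' he'e heD heD') (congrArg Subtype.val hxy))

/-- `H¹_{𝓕̄^*}(K, M̄^D)` finite ⇒ `H¹_{𝓕^*}(K, M^D)` finite (`H¹(eD')` is injective into it, using
`H¹(eD) ∘ H¹(eD') = id`). [cite: Howard2004HeegnerKolyvagin, Def. 2.1.10 (arXiv:1202.6340 p. 6)] -/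
theorem finite_dualSelmerGroup_of_induced (hee' : ∀ a, e' (e a) = a)
    (heD : ∀ (f : TateDual K Mbar n) (a : M), eD f a = f (e a))
    (heD' : ∀ (g : TateDual K M n) (b : Mbar), eD' g b = g (e' b))
    [hfind : Finite (inv.dualSelmerStructure ρbar (𝓕.induced e)).selmerGroup] :
    Finite (inv.dualSelmerStructure ρ 𝓕).selmerGroup := by
  have h₂ : ∀ g, eD (eD' g) = g := dual_comp_eq_self e' e eD' eD hee' heD' heD
  refine Finite.of_injective (fun z => (⟨galoisCohomology.map eD' 1 z.1, ?_⟩ :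
      (inv.dualSelmerStructure ρbar (𝓕.induced e)).selmerGroup)) ?_
  · rw [map_mem_dualSelmerGroup_induced_iff e eD inv 𝓕 heD, map_map_eq_self_of_comp_eq eD' eD h₂]
    exact z.2
  · intro x y hxy
    exact Subtype.ext (map_injective_of_comp_eq eD' eD h₂ (congrArg Subtype.val hxy))

end FiniteTransport

/-! ## §D (T3) Irreducibility (H.1) moves along a bijection -/

section Irreducible

variable {K : Type u} [Field K] {M Mbar : Type u}
  [AddCommGroup M] [TopologicalSpace M] [DiscreteTopology M]
  [AddCommGroup Mbar] [TopologicalSpace Mbar] [DiscreteTopology Mbar]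
  {ρ : DiscreteGaloisModule K M} {ρbar : DiscreteGaloisModule K Mbar}
  (e : ρ.toContRepresentation →ⁱL ρbar.toContRepresentation)
  (e' : ρbar.toContRepresentation →ⁱL ρ.toContRepresentation)

/-- **(T3) (H.1) transported from `M̄` to `M`**: if every `Γ_K`-stable subgroup of `M̄` is `⊥` or `⊤`
(Sakamoto's (H.1) in the tree's verbatim shape) and `e : M → M̄` is equivariant with a left
inverse `e'`, then every `Γ_K`-stable subgroup of `M` is `⊥` or `⊤` (image `e(H)` is stable;
`e` injective, `e'` surjects back). [cite: Sakamoto2024, §2 (H.1) (p. 921)] -/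
theorem irreducible_of_equiv (hee' : ∀ a, e' (e a) = a)
    (hirr : ∀ H : AddSubgroup Mbar,
      (∀ (σ : absoluteGaloisGroup K) (x : Mbar), x ∈ H → ρbar σ x ∈ H) → H = ⊥ ∨ H = ⊤) :
    ∀ H : AddSubgroup M,
      (∀ (σ : absoluteGaloisGroup K) (x : M), x ∈ H → ρ σ x ∈ H) → H = ⊥ ∨ H = ⊤ := by
  intro H hH
  have hstab : ∀ (σ : absoluteGaloisGroup K) (y : Mbar),
      y ∈ H.map (e : M →+ Mbar) → ρbar σ y ∈ H.map (e : M →+ Mbar) := by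
    rintro σ y ⟨x, hx, rfl⟩
    refine ⟨ρ σ x, hH σ x hx, ?_⟩
    have h := e.isIntertwining σ x
    simp only [ContinuousRep.toContRepresentation_apply_apply] at h
    exact h
  rcases hirr _ hstab with h | h
  · left
    rw [eq_bot_iff]
    intro x hx
    have : (e : M →+ Mbar) x ∈ H.map (e : M →+ Mbar) := ⟨x, hx, rfl⟩
    rw [h, AddSubgroup.mem_bot] at this
    rw [AddSubgroup.mem_bot, ← hee' x]
    change e' ((e : M →+ Mbar) x) = 0
    rw [this, map_zero]
  · right
    rw [eq_top_iff]
    intro x _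
    have : (e : M →+ Mbar) x ∈ H.map (e : M →+ Mbar) := by rw [h]; trivial
    obtain ⟨y, hy, hyx⟩ := this
    have : y = x := by
      have := congrArg e' hyx
      change e' (e y) = e' (e x) at this
      rwa [hee', hee'] at this
    exact this ▸ hy

end Irreducible


/-! ## §E (T4) Residual coisotropy moves along a bijection -/

section Coisotropic

variable {K : Type u} [Field K] [NumberField K] {M Mbar : Type u}
  [AddCommGroup M] [TopologicalSpace M] [DiscreteTopology M] [Finite M]
  [AddCommGroup Mbar] [TopologicalSpace Mbar] [DiscreteTopology Mbar] [Finite Mbar]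
  {ρ : DiscreteGaloisModule K M} {ρbar : DiscreteGaloisModule K Mbar} {n : ℕ}
  (e : ρ.toContRepresentation →ⁱL ρbar.toContRepresentation)
  (e' : ρbar.toContRepresentation →ⁱL ρ.toContRepresentation)
  (eD : (ρbar.tateDual n).toContRepresentation →ⁱL (ρ.tateDual n).toContRepresentation)
  (inv : LocalInvariants K n) (𝓕 : SelmerStructure ρ)
  (θ : ρbar.toContRepresentation →ⁱL (ρbar.tateDual n).toContRepresentation)

/-- **(T4, at a place) residual coisotropy transported along `e`**: if `𝓕̄ = 𝓕.induced e` is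
residually coisotropic at `v` for the self-duality `θ : M̄ → M̄^D` (Sakamoto Def. 3.8:
`θ_v⁻¹((𝓕̄_v)^*) ≤ 𝓕̄_v`), then `𝓕` is residually coisotropic at `v` for the transported self-duality
`eD ∘ θ ∘ e : M → M^D`. [cite: Sakamoto2024, Def. 3.8 (p. 924)] -/
theorem isResiduallyCoisotropicAt_of_induced (hee' : ∀ a, e' (e a) = a)
    (heD : ∀ (f : TateDual K Mbar n) (a : M), eD f a = f (e a)) (v : Place K)
    (h : inv.IsResiduallyCoisotropicAt (𝓕.induced e) θ v) :
    inv.IsResiduallyCoisotropicAt 𝓕 (eD.comp (θ.comp e)) v := by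
  intro x hx
  rw [LocalInvariants.mem_dualTransported_iff, localMap_comp_apply, localMap_comp_apply,
    LocalInvariants.dualSelmerStructure_apply,
    ← mem_dualLocalCondition_induced_iff e eD inv 𝓕 heD,
    ← LocalInvariants.dualSelmerStructure_apply, ← LocalInvariants.mem_dualTransported_iff] at hx
  exact (localMap_mem_induced_iff e e' 𝓕 hee' v x).1 (h hx)

/-- **(T4) residual coisotropy on `S` transported along `e`**:
`IsResiduallyCoisotropic inv (𝓕.induced e) θ S → IsResiduallyCoisotropic inv 𝓕 (eD ∘ θ ∘ e) S`.
[cite: Sakamoto2024, Def. 3.8 (p. 924)] -/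
theorem isResiduallyCoisotropic_of_induced (hee' : ∀ a, e' (e a) = a)
    (heD : ∀ (f : TateDual K Mbar n) (a : M), eD f a = f (e a)) {S : Finset (Place K)}
    (h : inv.IsResiduallyCoisotropic (𝓕.induced e) θ S) :
    inv.IsResiduallyCoisotropic 𝓕 (eD.comp (θ.comp e)) S :=
  fun v hv => isResiduallyCoisotropicAt_of_induced e e' eD inv 𝓕 θ hee' heD v (h v hv)

end Coisotropic

/-! ## §G (T5) Sakamoto's (H.3) moves along a bijection -/

section H3

variable {K : Type u} [Field K] {M Mbar : Type u}
  [AddCommGroup M] [TopologicalSpace M] [DiscreteTopology M]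
  [AddCommGroup Mbar] [TopologicalSpace Mbar] [DiscreteTopology Mbar]
  {ρ : DiscreteGaloisModule K M} {ρbar : DiscreteGaloisModule K Mbar}
  (e : ρ.toContRepresentation →ⁱL ρbar.toContRepresentation)
  (e' : ρbar.toContRepresentation →ⁱL ρ.toContRepresentation)

/-- **(T5) (H.3) transported from `M̄` to `M`** (the slice's inflation–restriction shape, with the
SAME vanishing condition `ρ u = 1 ∧ u ∈ rootsOfUnityFixer K N`): if every continuous crossed
homomorphism `f : Γ_K → M̄` vanishing on `{u | ρ u = 1, u fixes μ_N}` is a coboundary, then so is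
every such `f : Γ_K → M` — push `f` forward along `e` (`H¹(e)[f] = [e ∘ f]`,
`galoisCohomology.map_one_oneCocycleClass`) and use that `H¹(e)` is injective.
[cite: Sakamoto2024, §2 (H.3) (p. 921)] -/
theorem h3_of_equiv (hee' : ∀ a, e' (e a) = a) (N : ℕ)
    (hH3 : ∀ f : contOneCocycles ρbar.toTopRep,
      (∀ u : absoluteGaloisGroup K, ρ u = 1 → u ∈ rootsOfUnityFixer K N → f.1 u = 0) →
        oneCocycleClass ρbar.toTopRep f = 0) :
    ∀ f : contOneCocycles ρ.toTopRep,
      (∀ u : absoluteGaloisGroup K, ρ u = 1 → u ∈ rootsOfUnityFixer K N → f.1 u = 0) →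
        oneCocycleClass ρ.toTopRep f = 0 := by
  intro f hf
  have h0 : galoisCohomology.map e 1 (oneCocycleClass ρ.toTopRep f) = 0 := by
    rw [galoisCohomology.map_one_oneCocycleClass]
    refine hH3 _ fun u hu hμ => ?_
    change e (f.1 u) = 0
    rw [hf u hu hμ, map_zero]
  exact map_injective_of_comp_eq e e' hee' (h0.trans (map_zero _).symm)

end H3

/-! ## §F The `Nat.log` forms -/

section Log

variable {K : Type u} [Field K] [NumberField K] {M Mbar : Type u}
  [AddCommGroup M] [TopologicalSpace M] [DiscreteTopology M] [Finite M]
  [AddCommGroup Mbar] [TopologicalSpace Mbar] [DiscreteTopology Mbar] [Finite Mbar]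
  {ρ : DiscreteGaloisModule K M} {ρbar : DiscreteGaloisModule K Mbar} {n : ℕ}
  (e : ρ.toContRepresentation →ⁱL ρbar.toContRepresentation)
  (e' : ρbar.toContRepresentation →ⁱL ρ.toContRepresentation)
  (eD : (ρbar.tateDual n).toContRepresentation →ⁱL (ρ.tateDual n).toContRepresentation)
  (eD' : (ρ.tateDual n).toContRepresentation →ⁱL (ρbar.tateDual n).toContRepresentation)
  (inv : LocalInvariants K n) (𝓕 : SelmerStructure ρ)

omit [NumberField K] [Finite M] in
/-- A subgroup of an additive group killed by a prime `p` is trivial iff `Nat.log p` of its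
(finite) order vanishes: a non-zero element has order `p`, so `p ∣ #H`. [folklore] -/
theorem natLog_natCard_eq_zero_iff {G : Type*} [AddCommGroup G] {p : ℕ} [hp : Fact p.Prime]
    (hG : ∀ g : G, p • g = 0) (H : AddSubgroup G) [Finite H] :
    Nat.log p (Nat.card H) = 0 ↔ H = ⊥ := by
  rw [Nat.log_eq_zero_iff]
  refine ⟨?_, fun h => ?_⟩
  · rintro (hlt | hle)
    · by_contra hne
      obtain ⟨x, hx0⟩ := (AddSubgroup.ne_bot_iff_exists_ne_zero).1 hne
      have hord : addOrderOf x = p :=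
        addOrderOf_eq_prime (Subtype.ext (by simpa using hG x.1)) hx0
      have hdvd : p ∣ Nat.card H := hord ▸ addOrderOf_dvd_natCard x
      exact absurd (Nat.le_of_dvd Nat.card_pos hdvd) (not_le.2 hlt)
    · exact absurd hp.out.one_lt (not_lt.2 hle)
  · left
    rw [h, AddSubgroup.card_bot]
    exact hp.out.one_lt

end Log

end Summit.BirchSwinnertonDyer.Rank1Residual.GaloisImage.Transport

end
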